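import Literature.Analysis.ValidatedNumerics.TaylorModelIntegralCert2DTrig
import Literature.Analysis.ValidatedNumerics.TaylorFormQuadrature
import HarnessLib

/-!
# Double-integral certificates with algebraic edge weights (product integration on kd-trees)

Trunk T-ANA (Analysis/ValidatedNumerics); namespace `Literature.Analysis.ValidatedNumerics.PolyMP`.
Sequel of `TaylorModelIntegralCert2DAdaptive.lean` (kd-trees `KdTree2`, the final obligation `treeCheckG`),
`TaylorModelIntegralCert2DTrig.lean` (the code list `BExprT`, its box Taylor model `BExprT.model` / `tmem2_model`) and
`TaylorFormQuadrature.lean` (the end-point moments `logMoment`, `integral_shiftedPow_mul_logWeight`).  Subject: kernel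
certificates `lo ≤ ∫_{x0}^{x1} ∫_{y0}^{y1} w(x, y) F(x, y) dy dx ≤ hi` for the ALGEBRAIC EDGE WEIGHT
`w(x, y) = (x − x0)^{αl} (x1 − x)^{αr} (y − y0)^{βl} (y1 − y)^{βr}` with rational exponents (`> −1` where the factor is
singular; integrable edge and corner singularities `x^{-1/2} y^{-1/2}`, non-smooth factors `x^{1/2}`, Chebyshev-type
`(x(1−x))^{-1/2}`) and a code list `F : BExprT` — by PRODUCT INTEGRATION (op. cit. Sect. 2.5.6, 2.12.5): on every leaf the
smooth part is enclosed in a bivariate Taylor model, the rational midpoint rows of its polynomial are integrated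
EXACTLY against the moments of the weight, and the remainder is charged `δ · ∫ w`.

* **Part 0 — kd-tree certificates generic in the LEAF RULE** `Λ : Box2Q → EPrm → MI × Bool`: the claim `BoxClaimR`
  (membership + the integrability invariants), `tree_sound_rule`, the per-leaf obligation `leafCheckR` and
  `integral_bounds_of_leafCheckR` (the tree layer of `…2DAdaptive`, re-proved for an arbitrary integrand `f` and rule,
  since a weighted leaf is not a Taylor-model box);
* **Part 1 — weighted integration of rational rows against given moments** (`wsum`, `wsum2`,
  `integral2_weight_evalR2`) and **Part 2 — the weighted box estimate** `weighted_box`: for nonnegative integrable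
  direction weights `WX`, `WY` with moments `μ`, `ν` and `g ∈` a Taylor model `P` on `[−h, h] × [−k, k]`,
  `|∫∫ WX WY g − wsum2 μ ν q| · S ≤ tabs2 (P − q) · μ₀ · ν₀`, with the integrability of the sections and of the inner
  integral (bounded measurable times integrable);
* **Part 3 — EXACT RATIONAL MOMENTS of the edge factors** about the centre of a leaf at distance `s ≥ 0` from the edge:
  `∫_{-h}^{h} (u + s + h)^β uⁱ du` (`momG`, `integral_rpowG_mul_pow`; reflected `momGR`) from the end-point moments of
  `TaylorFormQuadrature`, made rational by POWER WITNESSES `r₀ = s^{β+1}`, `r₁ = (s + 2h)^{β+1}` that the kernel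
  re-checks (`witnessOK`: `r^{den} = w^{num}` by `decide`; the heuristic cuts at points whose distances to the singular
  edge are perfect powers, so that witnesses exist);
* **Part 4 — the leaf rule `leafEnclW`** over the ROOT box `R`: per direction a plan (`dirPlan`) saying which edge
  factor the moments carry (`dirW`, `dirMom`, `dirMom_sound`) — a touching edge always, a separated edge when its
  witnesses exist — the other factors entering the code list as `exp (α log (x − x0))` (`withPow`, `gexpr`; legitimate
  only on a leaf SEPARATED from that edge, which the acceptance flag checks, as it checks `B ⊆ R`); soundness
  `leafEnclW_sound : BoxClaimR S (wfun ω R F) B _`;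
* **Part 5 — the certificate** `leafCheckW` / `treeCheckW` / `integral_bounds_of_leafCheckW` (hypothesis-free real
  inequalities once the Boolean obligations hold, one `decide` per leaf) and the refinement heuristic `kdRefineW`
  (soundness-free: splits first a direction whose moments are rejected; cuts at `cutW` — at Pythagorean points when
  both edges of the direction carry square-root factors, else at points whose distance to the singular edge is a
  perfect power — so that the children keep their power witnesses).

Deliberately NOT here: logarithmic edge factors (`logMoment k ≥ 1` needs an enclosure of `log (2h)`), leaves on which
the moments carry BOTH edge factors of one direction (Beta-function moments — such a leaf is rejected and split),
interior or vertex-only singularities (reduce to edges by splitting the domain at the singular point, or by the graph /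
Duffy substitution of `…2DTrig` Part D), dimension `3`.  Problem-independent; no facts, no axioms; all certificate data
computable over `ℚ`.

## References

* P. J. Davis, P. Rabinowitz, *Methods of Numerical Integration*, 2nd ed., Academic Press (1984): Sect. 2.5.6 (product
  integration: integrate an approximation of the regular factor exactly against the weight, via its (modified)
  moments), Sect. 2.12.4 (away from the singularity the weight is an ordinary smooth factor), Sect. 2.12.5 (algebraic /
  Jacobi-type end-point singularities `(x − a)^α (b − x)^β`, `α, β > −1`, and the end-point moments (2.12.5.1)).
  [cite: DavisRabinowitz1984, Sect. 2.5.6] [cite: DavisRabinowitz1984, Sect. 2.12.4] [cite: DavisRabinowitz1984, Sect. 2.12.5]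
* K. Makino, M. Berz, *Taylor models and other validated functional inclusion methods*, Int. J. Pure Appl. Math. 4
  (2003) 379–456, Algorithm 2 (quadrature with Taylor models: exact integration of the polynomial part, the remainder
  bound times the measure). [cite: MakinoBerz2003, Algorithm 2]
* A. Mahboubi, G. Melquiond, T. Sibut-Pinote, *Formally verified approximations of definite integrals*, ITP 2016,
  LNCS 9807, 274–289, Sect. 3.3 (adaptive splitting of the domain; enclosures of the pieces added and checked by
  computation). [cite: MahboubiMelquiondSibutpinote2016, Sect. 3.3]
-/

open MeasureTheory intervalIntegral Set
open scoped Interval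

namespace Literature.Analysis.ValidatedNumerics

namespace PolyMP

open Literature.Analysis.ValidatedNumerics.NumericsMP
open Literature.Analysis.ValidatedNumerics.ExpPoly (Poly)
open Literature.Analysis.ValidatedNumerics.ExpPoly
open Literature.Analysis.ValidatedNumerics.TaylorForm

/-! ### Part 0. Adaptive certificates generic in the LEAF RULE -/

/-- **What a sound (scaled) enclosure `J` of `∫_{x0}^{x1} ∫_{y0}^{y1} f` provides downstream**: membership,
integrability of the inner integral on `[x0, x1]`, integrability of every section `y ↦ f x y`, `x ∈ [x0, x1]`, and the
orientation of the box (the induction invariant of the tree of sub-boxes, op. cit. Sect. 3.3).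
[cite: MahboubiMelquiondSibutpinote2016, Sect. 3.3] -/
def BoxClaimR (S : ℕ) (f : ℝ → ℝ → ℝ) (B : Box2Q) (J : MI) : Prop :=
  MI.mem S (∫ x in (B.x0 : ℝ)..B.x1, ∫ y in (B.y0 : ℝ)..B.y1, f x y) J ∧
    IntervalIntegrable (fun x => ∫ y in (B.y0 : ℝ)..B.y1, f x y) volume (B.x0 : ℝ) B.x1 ∧
    (∀ x : ℝ, (B.x0 : ℝ) ≤ x → x ≤ B.x1 → IntervalIntegrable (fun y => f x y) volume (B.y0 : ℝ) B.y1) ∧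
    B.x0 ≤ B.x1 ∧ B.y0 ≤ B.y1

/-- Every leaf accepted by the leaf rule `Λ` and inside its claim. [cite: MahboubiMelquiondSibutpinote2016, Sect. 3.3] -/
def leafClaimsOKR (Λ : Box2Q → EPrm → MI × Bool) (ls : List (Box2Q × EPrm × MI)) : Bool :=
  ls.all fun l =>
    let e := Λ l.1 l.2.1
    e.2 && decide (l.2.2.lo ≤ e.1.lo) && decide (e.1.hi ≤ l.2.2.hi)

/-- **Soundness of a checked tree for an ARBITRARY sound leaf rule** (structural induction: a leaf by the rule's
soundness and monotonicity of membership; an `x`-split by additivity over adjacent intervals; a `y`-split by additivity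
on every section and linearity of the outer integral). [cite: MahboubiMelquiondSibutpinote2016, Sect. 3.3] -/
theorem tree_sound_rule {S : ℕ} {f : ℝ → ℝ → ℝ} {Λ : Box2Q → EPrm → MI × Bool}
    (hΛ : ∀ (B : Box2Q) (P : EPrm), (Λ B P).2 = true → BoxClaimR S f B (Λ B P).1) :
    ∀ (t : KdTree2) (B : Box2Q), leafClaimsOKR Λ (t.leaves B) = true → BoxClaimR S f B t.total
  | KdTree2.leaf P J, B, hok => by
      simp only [KdTree2.leaves, leafClaimsOKR, List.all_cons, List.all_nil, Bool.and_true, Bool.and_eq_true,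
        decide_eq_true_eq] at hok
      obtain ⟨⟨hacc, hlo⟩, hhi⟩ := hok
      obtain ⟨hm, hI, hσ, hx, hy⟩ := hΛ B P hacc
      refine ⟨⟨?_, ?_⟩, hI, hσ, hx, hy⟩
      · exact le_trans (by exact_mod_cast hlo) hm.1
      · exact le_trans hm.2 (by exact_mod_cast hhi)
  | KdTree2.splitX c L R, B, hok => by
      simp only [KdTree2.leaves, leafClaimsOKR, List.all_append, Bool.and_eq_true] at hok
      obtain ⟨hmL, hIL, hσL, hxL, hyL⟩ := tree_sound_rule hΛ L ⟨B.x0, c, B.y0, B.y1⟩ (by simpa [leafClaimsOKR] using hok.1)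
      obtain ⟨hmR, hIR, hσR, hxR, hyR⟩ := tree_sound_rule hΛ R ⟨c, B.x1, B.y0, B.y1⟩ (by simpa [leafClaimsOKR] using hok.2)
      simp only at hmL hIL hσL hxL hyL hmR hIR hσR hxR hyR
      refine ⟨?_, hIL.trans hIR, ?_, hxL.trans hxR, hyL⟩
      · rw [KdTree2.total, ← intervalIntegral.integral_add_adjacent_intervals hIL hIR]
        exact MI.mem_add hmL hmR
      · intro x h0 h1
        rcases le_total x (c : ℝ) with hc | hc
        · exact hσL x h0 hc
        · exact hσR x hc h1
  | KdTree2.splitY c L R, B, hok => by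
      simp only [KdTree2.leaves, leafClaimsOKR, List.all_append, Bool.and_eq_true] at hok
      obtain ⟨hmL, hIL, hσL, hxL, hyL⟩ := tree_sound_rule hΛ L ⟨B.x0, B.x1, B.y0, c⟩ (by simpa [leafClaimsOKR] using hok.1)
      obtain ⟨hmR, hIR, hσR, hxR, hyR⟩ := tree_sound_rule hΛ R ⟨B.x0, B.x1, c, B.y1⟩ (by simpa [leafClaimsOKR] using hok.2)
      simp only at hmL hIL hσL hxL hyL hmR hIR hσR hxR hyR
      have hxx : (B.x0 : ℝ) ≤ B.x1 := by exact_mod_cast hxL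
      have hsec : ∀ x : ℝ, (B.x0 : ℝ) ≤ x → x ≤ B.x1 →
          (∫ y in (B.y0 : ℝ)..c, f x y) + ∫ y in (c : ℝ)..B.y1, f x y = ∫ y in (B.y0 : ℝ)..B.y1, f x y :=
        fun x h0 h1 => intervalIntegral.integral_add_adjacent_intervals (hσL x h0 h1) (hσR x h0 h1)
      have heqOn : EqOn (fun x => (∫ y in (B.y0 : ℝ)..c, f x y) + ∫ y in (c : ℝ)..B.y1, f x y)
          (fun x => ∫ y in (B.y0 : ℝ)..B.y1, f x y) (uIcc (B.x0 : ℝ) B.x1) := by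
        intro x hx
        rw [uIcc_of_le hxx] at hx
        exact hsec x hx.1 hx.2
      refine ⟨?_, ?_, fun x h0 h1 => (hσL x h0 h1).trans (hσR x h0 h1), hxL, hyL.trans hyR⟩
      · rw [KdTree2.total, ← intervalIntegral.integral_congr heqOn, intervalIntegral.integral_add hIL hIR]
        exact MI.mem_add hmL hmR
      · exact (hIL.add hIR).congr fun x hx => heqOn (uIoc_subset_uIcc hx)

/-- **Kernel obligation for leaf `i` under the leaf rule `Λ`**: leaf `i` of the tree over `B` is accepted by `Λ` and
its enclosure lies inside its claim; vacuously `true` past the last leaf. [cite: MahboubiMelquiondSibutpinote2016, Sect. 3.3] -/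
def leafCheckR (Λ : Box2Q → EPrm → MI × Bool) (t : KdTree2) (B : Box2Q) (i : ℕ) : Bool :=
  match (t.leaves B)[i]? with
  | none => true
  | some l =>
      let e := Λ l.1 l.2.1
      e.2 && decide (l.2.2.lo ≤ e.1.lo) && decide (e.1.hi ≤ l.2.2.hi)

/-- [folklore] -/
private theorem leafClaimsOKR_of_leafCheckR (Λ : Box2Q → EPrm → MI × Bool) (t : KdTree2) (B : Box2Q) {n : ℕ}
    (hn : t.size ≤ n) (H : ∀ i : ℕ, i < n → leafCheckR Λ t B i = true) : leafClaimsOKR Λ (t.leaves B) = true := by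
  unfold leafClaimsOKR
  refine List.all_eq_true.2 fun l hl => ?_
  obtain ⟨i, hi, rfl⟩ := List.getElem_of_mem hl
  have hlt : i < n := lt_of_lt_of_le (by simpa [KdTree2.length_leaves] using hi) hn
  have := H i hlt
  simp only [leafCheckR, List.getElem?_eq_getElem hi] at this
  exact this

/-- **Soundness of the adaptive certificate for an arbitrary leaf rule**: if `Λ` is sound for `f` (given `0 < S`),
every leaf obligation holds and the final obligation `treeCheckG` holds, then `lo ≤ ∫_{x0}^{x1} ∫_{y0}^{y1} f ≤ hi`.
[cite: MahboubiMelquiondSibutpinote2016, Sect. 3.3] -/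
theorem integral_bounds_of_leafCheckR {S : ℕ} {f : ℝ → ℝ → ℝ} {Λ : Box2Q → EPrm → MI × Bool}
    (hΛ : 0 < S → ∀ (B : Box2Q) (P : EPrm), (Λ B P).2 = true → BoxClaimR S f B (Λ B P).1)
    {t : KdTree2} {B : Box2Q} {n : ℕ} {lo hi : ℚ} (hleaf : ∀ i : ℕ, i < n → leafCheckR Λ t B i = true)
    (ht : treeCheckG S t n lo hi = true) :
    (lo : ℝ) ≤ ∫ x in (B.x0 : ℝ)..B.x1, ∫ y in (B.y0 : ℝ)..B.y1, f x y ∧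
      ∫ x in (B.x0 : ℝ)..B.x1, ∫ y in (B.y0 : ℝ)..B.y1, f x y ≤ (hi : ℝ) := by
  unfold treeCheckG at ht
  simp only [Bool.and_eq_true, decide_eq_true_eq] at ht
  obtain ⟨⟨⟨hS, hn⟩, hlo⟩, hhi⟩ := ht
  obtain ⟨⟨h1, h2⟩, -⟩ := tree_sound_rule (hΛ hS) t B (leafClaimsOKR_of_leafCheckR Λ t B hn hleaf)
  have hSr : (0 : ℝ) < S := by exact_mod_cast hS
  have hloR : (lo : ℝ) * S ≤ (t.total.lo : ℝ) := by exact_mod_cast hlo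
  have hhiR : (t.total.hi : ℝ) ≤ (hi : ℝ) * S := by exact_mod_cast hhi
  exact ⟨le_of_mul_le_mul_right (hloR.trans h1) hSr, le_of_mul_le_mul_right (h2.trans hhiR) hSr⟩

/-! ### Part 1. Weighted integrals of rational rows against given moments -/

/-- `wsum μ [c₀, c₁, …] i = Σ_j c_j · μ (i + j)`: a rational coefficient list paired with the moments `μ` of a weight
(the modified moments of product integration, op. cit. (2.5.6.3)). [cite: DavisRabinowitz1984, Sect. 2.5.6] -/
def wsum (μ : ℕ → ℚ) : List ℚ → ℕ → ℚ
  | [], _ => 0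
  | c :: cs, i => c * μ i + wsum μ cs (i + 1)

/-- The weighted double integral of rational rows: `Σ_i μ_i Σ_j q_ij ν_j`. [cite: DavisRabinowitz1984, Sect. 2.5.6] -/
def wsum2 (μ ν : ℕ → ℚ) (q : List Poly) : ℚ := wsum μ (q.map fun r => wsum ν r 0) 0

/-- [folklore] -/
private theorem continuous_evalR2_snd : ∀ (p : List (List ℝ)) (ρ : ℝ), Continuous fun σ => evalR2 p ρ σ
  | [], _ => by simpa using continuous_const
  | r :: rs, ρ => by
      simp only [evalR2_cons]
      exact (continuous_iff_continuousAt.2 fun x => (hasDerivAt_evalR r x).continuousAt).add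
        (continuous_const.mul (continuous_evalR2_snd rs ρ))

/-- **Product integration of one row**: if `∫_a^b W(x) xⁱ dx = μ_i` for all `i`, then
`∫_a^b W(x) xⁱ r(x) dx = wsum μ r i` for every rational coefficient list `r`. [cite: DavisRabinowitz1984, Sect. 2.5.6] -/
theorem integral_weight_mul_pow_mul_eval {W : ℝ → ℝ} {a b : ℝ} (hW : IntervalIntegrable W volume a b)
    {μ : ℕ → ℚ} (hμ : ∀ i : ℕ, ∫ x in a..b, W x * x ^ i = ((μ i : ℚ) : ℝ)) :
    ∀ (r : Poly) (i : ℕ), ∫ x in a..b, W x * x ^ i * Poly.eval r x = ((wsum μ r i : ℚ) : ℝ)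
  | [], i => by simp [wsum]
  | c :: cs, i => by
      have hpt : ∀ x : ℝ, W x * x ^ i * Poly.eval (c :: cs) x =
          (c : ℝ) * (W x * x ^ i) + W x * x ^ (i + 1) * Poly.eval cs x := by
        intro x; rw [Poly.eval_cons, pow_succ]; ring
      have h1 : IntervalIntegrable (fun x => (c : ℝ) * (W x * x ^ i)) volume a b :=
        (hW.mul_continuousOn (continuousOn_pow i)).const_mul _
      have h2 : IntervalIntegrable (fun x => W x * x ^ (i + 1) * Poly.eval cs x) volume a b :=
        (hW.mul_continuousOn (continuousOn_pow (i + 1))).mul_continuousOn (Poly.continuous_eval cs).continuousOn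
      simp_rw [hpt]
      rw [intervalIntegral.integral_add h1 h2, intervalIntegral.integral_const_mul, hμ i,
        integral_weight_mul_pow_mul_eval hW hμ cs (i + 1), wsum]
      push_cast; ring

/-- **Product integration of the rows of a bivariate array** (inner variable): if `∫_{-k}^{k} W(v) vʲ dv = ν_j` then
`∫_{-k}^{k} W(v) · Σ_i uⁱ q_i(v) dv = Σ_i uⁱ · wsum ν q_i 0`. [cite: DavisRabinowitz1984, Sect. 2.5.6] -/
theorem integral_weight_mul_evalR2 {W : ℝ → ℝ} {k : ℚ} (hW : IntervalIntegrable W volume (-(k : ℝ)) k)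
    {ν : ℕ → ℚ} (hν : ∀ j : ℕ, ∫ v in (-(k : ℝ))..k, W v * v ^ j = ((ν j : ℚ) : ℝ)) (u : ℝ) :
    ∀ q : List Poly, ∫ v in (-(k : ℝ))..k, W v * evalR2 (ratRows q) u v =
      Poly.eval (q.map fun r => wsum ν r 0) u
  | [] => by simp
  | r :: rs => by
      simp only [ratRows_cons, List.map_cons, evalR2_cons, Poly.eval_cons]
      have hpt : ∀ v : ℝ, W v * (evalR (r.map ((↑) : ℚ → ℝ)) v + u * evalR2 (ratRows rs) u v) =
          W v * v ^ 0 * Poly.eval r v + u * (W v * evalR2 (ratRows rs) u v) := by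
        intro v; rw [pow_zero, mul_one, Poly.eval_eq_evalR]; ring
      have h1 : IntervalIntegrable (fun v => W v * v ^ 0 * Poly.eval r v) volume (-(k : ℝ)) k :=
        (hW.mul_continuousOn (continuousOn_pow 0)).mul_continuousOn (Poly.continuous_eval r).continuousOn
      have h2 : IntervalIntegrable (fun v => u * (W v * evalR2 (ratRows rs) u v)) volume (-(k : ℝ)) k :=
        (hW.mul_continuousOn (continuous_evalR2_snd _ u).continuousOn).const_mul _
      simp_rw [hpt]
      rw [intervalIntegral.integral_add h1 h2, intervalIntegral.integral_const_mul,
        integral_weight_mul_pow_mul_eval hW hν r 0, integral_weight_mul_evalR2 hW hν u rs]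

/-- **Product integration of a bivariate rational array**: with moments `μ` in `u` and `ν` in `v`,
`∫_{-h}^{h} WX(u) ∫_{-k}^{k} WY(v) Σ_ij q_ij uⁱ vʲ dv du = wsum2 μ ν q`. [cite: DavisRabinowitz1984, Sect. 2.5.6] -/
theorem integral2_weight_evalR2 {WX WY : ℝ → ℝ} {h k : ℚ} (hX : IntervalIntegrable WX volume (-(h : ℝ)) h)
    (hY : IntervalIntegrable WY volume (-(k : ℝ)) k) {μ ν : ℕ → ℚ}
    (hμ : ∀ i : ℕ, ∫ u in (-(h : ℝ))..h, WX u * u ^ i = ((μ i : ℚ) : ℝ))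
    (hν : ∀ j : ℕ, ∫ v in (-(k : ℝ))..k, WY v * v ^ j = ((ν j : ℚ) : ℝ)) (q : List Poly) :
    ∫ u in (-(h : ℝ))..h, WX u * ∫ v in (-(k : ℝ))..k, WY v * evalR2 (ratRows q) u v = ((wsum2 μ ν q : ℚ) : ℝ) := by
  simp_rw [integral_weight_mul_evalR2 hY hν _ q]
  rw [wsum2, ← integral_weight_mul_pow_mul_eval hX hμ _ 0]
  refine intervalIntegral.integral_congr fun u _ => ?_
  simp

/-! ### Part 2. The weighted box estimate -/

/-- [folklore] -/
private theorem intervalIntegrable_weight_mul_bdd {W g : ℝ → ℝ} {k : ℚ} (k0 : 0 ≤ k)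
    (hW : IntervalIntegrable W volume (-(k : ℝ)) k) (hg : Measurable g) {M : ℝ}
    (hb : ∀ v : ℝ, |v| ≤ k → |g v| ≤ M) : IntervalIntegrable (fun v => W v * g v) volume (-(k : ℝ)) k := by
  have hk : (0 : ℝ) ≤ k := by exact_mod_cast k0
  have hle : (-(k : ℝ)) ≤ k := by linarith
  rw [intervalIntegrable_iff_integrableOn_Ioc_of_le hle] at hW ⊢
  refine Integrable.mul_bdd (c := M) hW hg.aestronglyMeasurable ?_
  refine (ae_restrict_iff' measurableSet_Ioc).2 (Filter.Eventually.of_forall fun v hv => ?_)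
  rw [Real.norm_eq_abs]
  exact hb v (abs_le.2 ⟨hv.1.le, hv.2⟩)

/-- **The weighted box estimate** (product integration of a Taylor model: op. cit. Sect. 2.12.4–2.12.5, "elimination
of the singularity" — the regular factor is expanded, the weight is integrated exactly against each monomial; in two
variables with a tensor weight `WX(u) · WY(v) ≥ 0`).  If `P` encloses a jointly measurable `g` on `|u| ≤ h, |v| ≤ k`
and `μ`, `ν` are the exact moments of the integrable weights, then for every list of rational rows `q`,
`|∫_{-h}^{h} ∫_{-k}^{k} WX WY g − wsum2 μ ν q| · S ≤ tabs2 (P − q) · μ₀ · ν₀`; moreover the weighted sections and the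
inner integral are interval integrable. [cite: DavisRabinowitz1984, Sect. 2.12.5] [cite: MakinoBerz2003, Algorithm 2] -/
theorem weighted_box {S : ℕ} (hS : 0 < S) {h k : ℚ} (h0 : 0 ≤ h) (k0 : 0 ≤ k)
    {g : ℝ → ℝ → ℝ} (hm : Measurable fun z : ℝ × ℝ => g z.1 z.2) {P : IPoly2} (hg : TMem2 S h k g P)
    {WX WY : ℝ → ℝ} (hYm : Measurable WY)
    (hXi : IntervalIntegrable WX volume (-(h : ℝ)) h) (hYi : IntervalIntegrable WY volume (-(k : ℝ)) k)
    (hX0 : ∀ u : ℝ, |u| ≤ h → 0 ≤ WX u) (hY0 : ∀ v : ℝ, |v| ≤ k → 0 ≤ WY v)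
    {μ ν : ℕ → ℚ} (hμ : ∀ i : ℕ, ∫ u in (-(h : ℝ))..h, WX u * u ^ i = ((μ i : ℚ) : ℝ))
    (hν : ∀ j : ℕ, ∫ v in (-(k : ℝ))..k, WY v * v ^ j = ((ν j : ℚ) : ℝ)) (q : List Poly) :
    |(∫ u in (-(h : ℝ))..h, ∫ v in (-(k : ℝ))..k, WX u * (WY v * g u v)) - ((wsum2 μ ν q : ℚ) : ℝ)| * S ≤
        (tabs2 S h k (tsub2 P (ratPoly2 S q)) : ℝ) * ((μ 0 : ℚ) : ℝ) * ((ν 0 : ℚ) : ℝ) ∧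
      IntervalIntegrable (fun u => ∫ v in (-(k : ℝ))..k, WX u * (WY v * g u v)) volume (-(h : ℝ)) h ∧
      ∀ u : ℝ, |u| ≤ h → IntervalIntegrable (fun v => WX u * (WY v * g u v)) volume (-(k : ℝ)) k := by
  have hSr : (0 : ℝ) < S := by exact_mod_cast hS
  have hS0 : (S : ℝ) ≠ 0 := hSr.ne'
  have hhr : (0 : ℝ) ≤ h := by exact_mod_cast h0
  have hkr : (0 : ℝ) ≤ k := by exact_mod_cast k0
  have hkk : (-(k : ℝ)) ≤ k := by linarith
  have hhh : (-(h : ℝ)) ≤ h := by linarith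
  set A : ℤ := tabs2 S h k P with hA_def
  set Bd : ℤ := tabs2 S h k (tsub2 P (ratPoly2 S q)) with hBd_def
  -- pointwise bounds from the models
  have hA : ∀ u v : ℝ, |u| ≤ h → |v| ≤ k → |g u v| ≤ (A : ℝ) / S := fun u v hu hv => by
    rw [le_div_iff₀ hSr]; exact abs_le_tabs2 h0 k0 hg hu hv
  have hdiff := tmem2_sub hg (tmem2_ratPoly2 S h k q)
  have hD : ∀ u v : ℝ, |u| ≤ h → |v| ≤ k →
      |g u v - evalR2 (ratRows q) u v| ≤ (Bd : ℝ) / S := fun u v hu hv => by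
    rw [le_div_iff₀ hSr]; exact abs_le_tabs2 h0 k0 hdiff hu hv
  -- the moments of order `0`
  have hμ0 : ∫ u in (-(h : ℝ))..h, WX u = ((μ 0 : ℚ) : ℝ) := by
    rw [← hμ 0]; exact intervalIntegral.integral_congr fun u _ => by simp
  have hν0 : ∫ v in (-(k : ℝ))..k, WY v = ((ν 0 : ℚ) : ℝ) := by
    rw [← hν 0]; exact intervalIntegral.integral_congr fun v _ => by simp
  -- sections
  have hsec : ∀ u : ℝ, Measurable fun v => g u v := fun u => hm.comp measurable_prodMk_left
  have hIv : ∀ u : ℝ, |u| ≤ h → IntervalIntegrable (fun v => WY v * g u v) volume (-(k : ℝ)) k := fun u hu =>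
    intervalIntegrable_weight_mul_bdd k0 hYi (hsec u) fun v hv => hA u v hu hv
  have hIσ : ∀ u : ℝ, |u| ≤ h → IntervalIntegrable (fun v => WX u * (WY v * g u v)) volume (-(k : ℝ)) k :=
    fun u hu => (hIv u hu).const_mul _
  -- the inner weighted integral `u ↦ ∫ WY(v) g(u, v) dv`: measurable (a Fubini integrand) and bounded
  have hG1m : Measurable fun u => ∫ v in (-(k : ℝ))..k, WY v * g u v := by
    have hj : Measurable fun z : ℝ × ℝ => WY z.2 * g z.1 z.2 := (hYm.comp measurable_snd).mul hm
    have hsm : StronglyMeasurable (Function.uncurry fun u v => WY v * g u v) := hj.stronglyMeasurable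
    have h1 : StronglyMeasurable fun u => ∫ v, WY v * g u v ∂(volume.restrict (Set.Ioc (-(k : ℝ)) k)) :=
      hsm.integral_prod_right
    have e : (fun u => ∫ v in (-(k : ℝ))..k, WY v * g u v) =
        fun u => ∫ v, WY v * g u v ∂(volume.restrict (Set.Ioc (-(k : ℝ)) k)) := by
      funext u; rw [intervalIntegral.integral_of_le hkk]
    rw [e]; exact h1.measurable
  have hG1b : ∀ u : ℝ, |u| ≤ h → |∫ v in (-(k : ℝ))..k, WY v * g u v| ≤ (A : ℝ) / S * ((ν 0 : ℚ) : ℝ) := by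
    intro u hu
    have hpt : ∀ᵐ v : ℝ, v ∈ Set.Ioc (-(k : ℝ)) k → ‖WY v * g u v‖ ≤ (A : ℝ) / S * WY v := by
      refine Filter.Eventually.of_forall fun v hv => ?_
      have hv' : |v| ≤ k := abs_le.2 ⟨hv.1.le, hv.2⟩
      rw [Real.norm_eq_abs, abs_mul, abs_of_nonneg (hY0 v hv')]
      calc WY v * |g u v| ≤ WY v * ((A : ℝ) / S) := mul_le_mul_of_nonneg_left (hA u v hu hv') (hY0 v hv')
        _ = (A : ℝ) / S * WY v := by ring
    have := intervalIntegral.norm_integral_le_of_norm_le hkk hpt (hYi.const_mul _)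
    rw [intervalIntegral.integral_const_mul, hν0, Real.norm_eq_abs] at this
    exact this
  have hIρ' : IntervalIntegrable (fun u => WX u * ∫ v in (-(k : ℝ))..k, WY v * g u v) volume (-(h : ℝ)) h :=
    intervalIntegrable_weight_mul_bdd h0 hXi hG1m fun u hu => hG1b u hu
  have e : (fun u => ∫ v in (-(k : ℝ))..k, WX u * (WY v * g u v)) =
      fun u => WX u * ∫ v in (-(k : ℝ))..k, WY v * g u v := by
    funext u; exact intervalIntegral.integral_const_mul _ _
  have hIρ : IntervalIntegrable (fun u => ∫ v in (-(k : ℝ))..k, WX u * (WY v * g u v)) volume (-(h : ℝ)) h := by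
    rw [e]; exact hIρ'
  refine ⟨?_, hIρ, hIσ⟩
  -- the estimate: subtract the exactly integrated rational rows, bound pointwise twice against the weights
  have hQ : IntervalIntegrable (fun u => WX u * ∫ v in (-(k : ℝ))..k, WY v * evalR2 (ratRows q) u v)
      volume (-(h : ℝ)) h := by
    simp_rw [integral_weight_mul_evalR2 hYi hν _ q]
    exact hXi.mul_continuousOn (Poly.continuous_eval _).continuousOn
  rw [← integral2_weight_evalR2 hXi hYi hμ hν q, e, ← intervalIntegral.integral_sub hIρ' hQ]
  have hpt : ∀ᵐ u : ℝ, u ∈ Set.Ioc (-(h : ℝ)) h →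
      ‖WX u * (∫ v in (-(k : ℝ))..k, WY v * g u v) -
          WX u * ∫ v in (-(k : ℝ))..k, WY v * evalR2 (ratRows q) u v‖ ≤
        (Bd : ℝ) / S * ((ν 0 : ℚ) : ℝ) * WX u := by
    refine Filter.Eventually.of_forall fun u hu' => ?_
    have hu : |u| ≤ h := abs_le.2 ⟨hu'.1.le, hu'.2⟩
    have hin : |(∫ v in (-(k : ℝ))..k, WY v * g u v) - ∫ v in (-(k : ℝ))..k, WY v * evalR2 (ratRows q) u v| ≤
        (Bd : ℝ) / S * ((ν 0 : ℚ) : ℝ) := by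
      rw [← intervalIntegral.integral_sub (hIv u hu)
        (hYi.mul_continuousOn (continuous_evalR2_snd _ u).continuousOn)]
      have hpt' : ∀ᵐ v : ℝ, v ∈ Set.Ioc (-(k : ℝ)) k →
          ‖WY v * g u v - WY v * evalR2 (ratRows q) u v‖ ≤ (Bd : ℝ) / S * WY v := by
        refine Filter.Eventually.of_forall fun v hv => ?_
        have hv' : |v| ≤ k := abs_le.2 ⟨hv.1.le, hv.2⟩
        rw [← mul_sub, Real.norm_eq_abs, abs_mul, abs_of_nonneg (hY0 v hv')]
        calc WY v * |g u v - evalR2 (ratRows q) u v| ≤ WY v * ((Bd : ℝ) / S) :=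
            mul_le_mul_of_nonneg_left (hD u v hu hv') (hY0 v hv')
          _ = (Bd : ℝ) / S * WY v := by ring
      have := intervalIntegral.norm_integral_le_of_norm_le hkk hpt' (hYi.const_mul _)
      rw [intervalIntegral.integral_const_mul, hν0, Real.norm_eq_abs] at this
      exact this
    rw [← mul_sub, Real.norm_eq_abs, abs_mul, abs_of_nonneg (hX0 u hu)]
    calc WX u * |(∫ v in (-(k : ℝ))..k, WY v * g u v) - ∫ v in (-(k : ℝ))..k, WY v * evalR2 (ratRows q) u v|
          ≤ WX u * ((Bd : ℝ) / S * ((ν 0 : ℚ) : ℝ)) := mul_le_mul_of_nonneg_left hin (hX0 u hu)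
      _ = (Bd : ℝ) / S * ((ν 0 : ℚ) : ℝ) * WX u := by ring
  have := intervalIntegral.norm_integral_le_of_norm_le hhh hpt (hXi.const_mul _)
  rw [intervalIntegral.integral_const_mul, hμ0, Real.norm_eq_abs] at this
  have h1 := mul_le_mul_of_nonneg_right this hSr.le
  have h2 : (Bd : ℝ) / S * ((ν 0 : ℚ) : ℝ) * ((μ 0 : ℚ) : ℝ) * S = (Bd : ℝ) * ((μ 0 : ℚ) : ℝ) * ((ν 0 : ℚ) : ℝ) := by
    field_simp
  rw [h2] at h1
  exact h1

/-! ### Part 3. Exact moments of the edge weights (rational, via power witnesses) -/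

/-- `⌊n^{1/d}⌋` by bisection with fuel (a soundness-free search: its output is re-checked). [folklore] -/
private def natRootAux (d n : ℕ) : ℕ → ℕ → ℕ → ℕ
  | 0, a, _ => a
  | fuel + 1, a, b =>
      if b ≤ a + 1 then a
      else
        let m := (a + b) / 2
        if m ^ d ≤ n then natRootAux d n fuel m b else natRootAux d n fuel a m

/-- `⌊n^{1/d}⌋` (for `n < 2^400`; soundness-free). [folklore] -/
private def natRoot (d n : ℕ) : ℕ := natRootAux d n 400 0 (n + 1)

/-- **Power witness**: a rational candidate `r` for `w^q`, `q = p/d > 0` (the `d`-th root of `w^p` taken on numerator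
and denominator; meaningful when `w^p` is a perfect `d`-th power, e.g. `w = 2^{-dj}`). Soundness-free: re-checked by
`witnessOK`. [cite: DavisRabinowitz1984, Sect. 2.12.5] -/
def powWitness (w q : ℚ) : ℚ :=
  let W := w ^ q.num.toNat
  (natRoot q.den W.num.toNat : ℚ) / (natRoot q.den W.den : ℚ)

/-- **The witness check** `0 < w`, `0 < q`, `0 ≤ r`, `r^{den q} = w^{num q}` — i.e. `r = w^q` exactly.
[cite: DavisRabinowitz1984, Sect. 2.12.5] -/
def witnessOK (w q r : ℚ) : Bool :=
  decide (0 < w) && decide (0 < q) && decide (0 ≤ r) && decide (r ^ q.den = w ^ q.num.toNat)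

/-- **Soundness of the witness check**: `r = w^q` as real numbers. [cite: DavisRabinowitz1984, Sect. 2.12.5] -/
theorem witnessOK_sound {w q r : ℚ} (hok : witnessOK w q r = true) :
    0 < w ∧ 0 < q ∧ (r : ℝ) = (w : ℝ) ^ (q : ℝ) := by
  simp only [witnessOK, Bool.and_eq_true, decide_eq_true_eq] at hok
  obtain ⟨⟨⟨hw, hq⟩, hr⟩, hpow⟩ := hok
  refine ⟨hw, hq, ?_⟩
  have hnum : 0 < q.num := Rat.num_pos.2 hq
  have hp : ((q.num.toNat : ℕ) : ℤ) = q.num := Int.toNat_of_nonneg hnum.le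
  have hd : q.den ≠ 0 := q.den_nz
  have hwr : (0 : ℝ) ≤ w := by exact_mod_cast hw.le
  have hrr : (0 : ℝ) ≤ r := by exact_mod_cast hr
  have hqr : (q : ℝ) = (q.num.toNat : ℝ) * ((q.den : ℝ)⁻¹) := by
    rw [Rat.cast_def, div_eq_mul_inv]
    congr 1
    exact_mod_cast hp.symm
  have hpowR : (r : ℝ) ^ q.den = (w : ℝ) ^ q.num.toNat := by exact_mod_cast hpow
  rw [hqr, Real.rpow_mul hwr, Real.rpow_natCast, ← hpowR, Real.pow_rpow_inv_natCast hrr hd]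

/-- Plain moments `∫_{-k}^{k} vⁱ dv = (k^{i+1} − (−k)^{i+1})/(i+1)`. [cite: DavisRabinowitz1984, Sect. 2.5.6] -/
def momP (k : ℚ) (i : ℕ) : ℚ := (k ^ (i + 1) - (-k) ^ (i + 1)) / (i + 1)

/-- [cite: DavisRabinowitz1984, Sect. 2.5.6] -/
theorem integral_one_mul_pow (k : ℚ) (i : ℕ) :
    ∫ v in (-(k : ℝ))..k, (1 : ℝ) * v ^ i = ((momP k i : ℚ) : ℝ) := by
  simp only [one_mul, integral_pow, momP]
  push_cast
  ring

/-- **Power witness at distance `s ≥ 0`** from the singular edge: `0` for `s = 0`, else `powWitness`.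
Soundness-free. [cite: DavisRabinowitz1984, Sect. 2.12.5] -/
def powWitness0 (s q : ℚ) : ℚ := if s = 0 then 0 else powWitness s q

/-- Witness check admitting `s = 0` (then `r = 0` and `q > 0`): `r = s^q` exactly. [cite: DavisRabinowitz1984, Sect. 2.12.5] -/
def witness0OK (s q r : ℚ) : Bool :=
  (decide (s = 0) && decide (r = 0) && decide (0 < q)) || witnessOK s q r

/-- [cite: DavisRabinowitz1984, Sect. 2.12.5] -/
theorem witness0OK_sound {s q r : ℚ} (hok : witness0OK s q r = true) :
    0 ≤ s ∧ 0 < q ∧ (r : ℝ) = (s : ℝ) ^ (q : ℝ) := by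
  simp only [witness0OK, Bool.or_eq_true, Bool.and_eq_true, decide_eq_true_eq] at hok
  rcases hok with ⟨⟨hs, hr⟩, hq⟩ | h
  · refine ⟨hs.symm.le, hq, ?_⟩
    have hq' : (q : ℝ) ≠ 0 := by exact_mod_cast hq.ne'
    rw [hs, hr, Rat.cast_zero, Real.zero_rpow hq']
  · obtain ⟨hw, hq, e⟩ := witnessOK_sound h
    exact ⟨hw.le, hq, e⟩

/-- **Edge moments about the leaf centre** for a leaf at distance `s ≥ 0` from the singular edge (half-width `h`):
`∫_{-h}^{h} (u + s + h)^β uⁱ du = Σ_{l ≤ i} C(i,l) (−(s+h))^{i−l} (r₁ (s+2h)^l − r₀ s^l)/(β+l+1)` with the power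
witnesses `r₁ = (s+2h)^{β+1}`, `r₀ = s^{β+1}` (op. cit. (2.12.5.1), re-expanded binomially about the centre; the
touching case is `s = 0`, `r₀ = 0`; binomials as `descFactorial / factorial`). [cite: DavisRabinowitz1984, Sect. 2.12.5] -/
def momG (h s β r0 r1 : ℚ) (i : ℕ) : ℚ :=
  ∑ l ∈ Finset.range (i + 1),
    ((i.descFactorial l / l.factorial : ℕ) : ℚ) * (-(s + h)) ^ (i - l) *
      ((r1 * (s + 2 * h) ^ l - r0 * s ^ l) / (β + l + 1))

/-- **Right-edge moments** `∫_{-h}^{h} (s + h − u)^β uⁱ du = (−1)ⁱ · momG` (reflection `u ↦ −u`).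
[cite: DavisRabinowitz1984, Sect. 2.12.5] -/
def momGR (h s β r0 r1 : ℚ) (i : ℕ) : ℚ := (-1) ^ i * momG h s β r0 r1 i

/-- **The edge moments are exact**: for `−1 < β`, `0 ≤ h`, `0 ≤ s`, `r₀ = s^{β+1}`, `r₁ = (s+2h)^{β+1}`,
`∫_{-h}^{h} (u + (s+h))^β uⁱ du = momG h s β r₀ r₁ i` (shift to `[s, s+2h] = [0, s+2h] ∖ [0, s]` and the end-point
moment formula). [cite: DavisRabinowitz1984, Sect. 2.12.5] -/
theorem integral_rpowG_mul_pow {h s β r0 r1 : ℚ} (hβ : -1 < β) (hh : 0 ≤ h) (hs : 0 ≤ s)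
    (hr0 : (r0 : ℝ) = (s : ℝ) ^ ((β : ℝ) + 1)) (hr1 : (r1 : ℝ) = ((s : ℝ) + 2 * h) ^ ((β : ℝ) + 1)) (i : ℕ) :
    ∫ u in (-(h : ℝ))..h, (u + ((s + h : ℚ) : ℝ)) ^ (β : ℝ) * u ^ i = ((momG h s β r0 r1 i : ℚ) : ℝ) := by
  have hβr : (-1 : ℝ) < β := by exact_mod_cast hβ
  have hhr : (0 : ℝ) ≤ h := by exact_mod_cast hh
  have hsr : (0 : ℝ) ≤ s := by exact_mod_cast hs
  have hs1 : (0 : ℝ) ≤ (s : ℝ) + 2 * h := by linarith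
  set m : ℝ := ((s + h : ℚ) : ℝ) with hm
  have hm' : m = (s : ℝ) + h := by rw [hm]; push_cast; ring
  -- shift to `[s, s + 2h]`
  have hshift := intervalIntegral.integral_comp_add_right
    (fun t : ℝ => (t - m) ^ i * (t ^ (β : ℝ) * Real.log t ^ 0)) m (a := -(h : ℝ)) (b := h)
  have e1 : (-(h : ℝ)) + m = s := by rw [hm']; ring
  have e2 : (h : ℝ) + m = (s : ℝ) + 2 * h := by rw [hm']; ring
  rw [e1, e2] at hshift
  have hpt : ∀ u : ℝ, (u + m) ^ (β : ℝ) * u ^ i = (u + m - m) ^ i * ((u + m) ^ (β : ℝ) * Real.log (u + m) ^ 0) := by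
    intro u; rw [pow_zero, mul_one, add_sub_cancel_right, mul_comm]
  simp_rw [hpt]
  rw [hshift]
  -- `∫_s^{s+2h} = ∫_0^{s+2h} − ∫_0^s`
  have hint : ∀ c : ℝ, IntervalIntegrable (fun t : ℝ => (t - m) ^ i * (t ^ (β : ℝ) * Real.log t ^ 0)) volume 0 c := by
    intro c
    have h1 : IntervalIntegrable (fun t : ℝ => t ^ (β : ℝ)) volume 0 c :=
      intervalIntegral.intervalIntegrable_rpow' hβr
    have h2 : IntervalIntegrable (fun t : ℝ => t ^ (β : ℝ) * Real.log t ^ 0) volume 0 c := by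
      simpa only [pow_zero, mul_one] using h1
    exact h2.continuousOn_mul ((continuous_id.sub continuous_const).pow i).continuousOn
  rw [← intervalIntegral.integral_interval_sub_left (hint _) (hint _),
    integral_shiftedPow_mul_logWeight hβr 0 i m hs1, integral_shiftedPow_mul_logWeight hβr 0 i m hsr,
    ← Finset.sum_sub_distrib, momG]
  push_cast
  refine Finset.sum_congr rfl fun l _ => ?_
  have hl0 : (0 : ℝ) ≤ l := Nat.cast_nonneg l
  have hβl : (-1 : ℝ) < β + l := by linarith
  have key : ∀ x : ℝ, 0 ≤ x → ∀ r : ℝ, r = x ^ ((β : ℝ) + 1) → x ^ ((β : ℝ) + l + 1) = r * x ^ l := by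
    intro x hx r hr
    have hne : ((β : ℝ) + 1) + (l : ℝ) ≠ 0 := (by linarith : (0 : ℝ) < ((β : ℝ) + 1) + (l : ℝ)).ne'
    rw [hr, show (β : ℝ) + l + 1 = ((β : ℝ) + 1) + (l : ℝ) by ring, Real.rpow_add' hx hne, Real.rpow_natCast]
  rw [logMoment_zero hβl, logMoment_zero hβl, ← Nat.choose_eq_descFactorial_div_factorial,
    key _ hs1 _ hr1, key _ hsr _ hr0, hm']
  ring

/-- **The right-edge moments are exact**: `∫_{-h}^{h} ((s+h) − u)^β uⁱ du = momGR h s β r₀ r₁ i`.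
[cite: DavisRabinowitz1984, Sect. 2.12.5] -/
theorem integral_rpowGR_mul_pow {h s β r0 r1 : ℚ} (hβ : -1 < β) (hh : 0 ≤ h) (hs : 0 ≤ s)
    (hr0 : (r0 : ℝ) = (s : ℝ) ^ ((β : ℝ) + 1)) (hr1 : (r1 : ℝ) = ((s : ℝ) + 2 * h) ^ ((β : ℝ) + 1)) (i : ℕ) :
    ∫ u in (-(h : ℝ))..h, (((s + h : ℚ) : ℝ) - u) ^ (β : ℝ) * u ^ i = ((momGR h s β r0 r1 i : ℚ) : ℝ) := by
  set m : ℝ := ((s + h : ℚ) : ℝ) with hm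
  have hpt : ∀ u : ℝ, (m - u) ^ (β : ℝ) * u ^ i = (-1) ^ i * ((-u + m) ^ (β : ℝ) * (-u) ^ i) := by
    intro u
    have h1 : ((-1 : ℝ) ^ i) * (-1) ^ i = 1 := by rw [← mul_pow]; norm_num
    calc (m - u) ^ (β : ℝ) * u ^ i = ((-1 : ℝ) ^ i * (-1) ^ i) * ((m - u) ^ (β : ℝ) * u ^ i) := by
          rw [h1, one_mul]
      _ = (-1) ^ i * ((-u + m) ^ (β : ℝ) * (-u) ^ i) := by
          rw [show (-u : ℝ) + m = m - u by ring, neg_pow u i]; ring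
  simp_rw [hpt]
  rw [intervalIntegral.integral_const_mul,
    intervalIntegral.integral_comp_neg (fun u : ℝ => (u + m) ^ (β : ℝ) * u ^ i), neg_neg,
    integral_rpowG_mul_pow hβ hh hs hr0 hr1 i, momGR]
  push_cast
  ring

/-! ### Part 4. Edge weights, the leaf rule and its soundness -/

/-- **Weight descriptor**: the exponents of the algebraic edge weight
`w(x, y) = (x − x0)^{xl} (x1 − x)^{xr} (y − y0)^{yl} (y1 − y)^{yr}` attached to the ROOT box `[x0, x1] × [y0, y1]`
(an exponent `0` means no factor; a nonzero exponent must exceed `−1` on every leaf touching its edge — Jacobi-type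
end-point singularities, op. cit. Sect. 2.12.5 with (2.12.5.5)). [cite: DavisRabinowitz1984, Sect. 2.12.5] -/
structure WPrm where
  /-- exponent at the left edge `x = x0` -/
  xl : ℚ
  /-- exponent at the right edge `x = x1` -/
  xr : ℚ
  /-- exponent at the lower edge `y = y0` -/
  yl : ℚ
  /-- exponent at the upper edge `y = y1` -/
  yr : ℚ

/-- One direction's edge weight `(t − a)^α (b − t)^β` (real powers). [cite: DavisRabinowitz1984, Sect. 2.12.5] -/
noncomputable def edgeW (a b α β : ℚ) (t : ℝ) : ℝ := (t - a) ^ (α : ℝ) * ((b : ℝ) - t) ^ (β : ℝ)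

/-- **The weighted integrand** `(x − x0)^{xl} (x1 − x)^{xr} · ((y − y0)^{yl} (y1 − y)^{yr} · F(x, y))` on the root box
`R = [x0, x1] × [y0, y1]`. [cite: DavisRabinowitz1984, Sect. 2.12.5] -/
noncomputable def wfun (ω : WPrm) (R : Box2Q) (F : BExprT) (x y : ℝ) : ℝ :=
  edgeW R.x0 R.x1 ω.xl ω.xr x * (edgeW R.y0 R.y1 ω.yl ω.yr y * F.toFun₂ x y)

/-- Moment part of a LEFT edge factor in the leaf's local coordinate `u ∈ [−h, h]`: `(u + m)^α`, `m = h + (distance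
of the leaf to the edge)`, if the moments carry the factor (`t`), else `1`. [cite: DavisRabinowitz1984, Sect. 2.12.5] -/
noncomputable def wL (t : Bool) (h α : ℚ) (u : ℝ) : ℝ := if t then (u + h) ^ (α : ℝ) else 1

/-- Moment part of a RIGHT edge factor: `(m − u)^α` if carried by the moments, else `1`. [cite: DavisRabinowitz1984, Sect. 2.12.5] -/
noncomputable def wR (t : Bool) (h α : ℚ) (u : ℝ) : ℝ := if t then ((h : ℝ) - u) ^ (α : ℝ) else 1

/-- [cite: DavisRabinowitz1984, Sect. 2.12.5] -/
@[simp] theorem wL_true (h α : ℚ) (u : ℝ) : wL true h α u = (u + h) ^ (α : ℝ) := by simp [wL]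

/-- [cite: DavisRabinowitz1984, Sect. 2.12.5] -/
@[simp] theorem wL_false (h α : ℚ) (u : ℝ) : wL false h α u = 1 := by simp [wL]

/-- [cite: DavisRabinowitz1984, Sect. 2.12.5] -/
@[simp] theorem wR_true (h α : ℚ) (u : ℝ) : wR true h α u = ((h : ℝ) - u) ^ (α : ℝ) := by simp [wR]

/-- [cite: DavisRabinowitz1984, Sect. 2.12.5] -/
@[simp] theorem wR_false (h α : ℚ) (u : ℝ) : wR false h α u = 1 := by simp [wR]

/-- Code-list part of an edge factor with base `s`: the smooth factor `exp (α log s)` (`= s^α` for `s > 0`) on a leaf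
SEPARATED from that edge, `1` if the edge is carried by the moments (`t`) or `α = 0` (op. cit. Sect. 2.12.4: away
from the singularity the weight is an ordinary smooth factor). [cite: DavisRabinowitz1984, Sect. 2.12.4] -/
noncomputable def facR (t : Bool) (α : ℚ) (s : ℝ) : ℝ :=
  if (!t && decide (α ≠ 0)) = true then Real.exp ((α : ℝ) * Real.log s) else 1

/-- Attach the code-list factor `A^α = exp (α · log A)` to `E` unless the edge is carried by the moments or `α = 0`.
[cite: DavisRabinowitz1984, Sect. 2.12.4] -/
def withPow (t : Bool) (α : ℚ) (A E : BExprT) : BExprT :=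
  if (!t && decide (α ≠ 0)) = true then
    BExprT.mul E (BExprT.exp (BExprT.mul (BExprT.const α) (BExprT.log A)))
  else E

/-- [cite: DavisRabinowitz1984, Sect. 2.12.4] -/
theorem toFun₂_withPow (t : Bool) (α : ℚ) (A E : BExprT) (x y : ℝ) :
    (withPow t α A E).toFun₂ x y = E.toFun₂ x y * facR t α (A.toFun₂ x y) := by
  unfold withPow facR
  by_cases hb : (!t && decide (α ≠ 0)) = true
  · rw [if_pos hb, if_pos hb]
    simp only [BExprT.toFun₂]
  · rw [if_neg hb, if_neg hb, mul_one]

/-- **Splitting a left edge factor on a leaf** `[x0, x1] ⊆ [a, ∞)` with centre `c`: for `x0 ≤ x`,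
`(x − a)^α = wL t m α (x − c) · facR t α (x − a)` where `c − m = a` — if the moments carry the factor (`t`) it is the
weight `(u + m)^α` (`m = h +` distance to the edge), otherwise the smooth code-list factor `exp (α log (x − a))`,
legitimate on a leaf SEPARATED from the edge (`a < x0`), and `1` for `α = 0`. [cite: DavisRabinowitz1984, Sect. 2.12.4] -/
theorem rpow_left_split {a x0 α c m : ℚ} (hcm : c - m = a) {t : Bool} (hsep : t = false → α ≠ 0 → a < x0)
    {x : ℝ} (hx : (x0 : ℝ) ≤ x) : (x - a) ^ (α : ℝ) = wL t m α (x - c) * facR t α (x - a) := by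
  cases t
  · simp only [wL_false, one_mul, facR, Bool.not_false, Bool.true_and, decide_eq_true_eq]
    by_cases hα : α = 0
    · simp [hα]
    · have hlt : (a : ℝ) < x := lt_of_lt_of_le (by exact_mod_cast hsep rfl hα) hx
      rw [if_pos hα, Real.rpow_def_of_pos (sub_pos.2 hlt), mul_comm (Real.log _)]
  · simp only [wL_true, facR, Bool.not_true, Bool.false_and, Bool.false_eq_true, if_false, mul_one]
    have : (c : ℝ) - m = a := by exact_mod_cast hcm
    congr 1
    linarith

/-- **Splitting a right edge factor on a leaf** `[x0, x1] ⊆ (−∞, b]` (`c + m = b`): for `x ≤ x1`,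
`(b − x)^α = wR t m α (x − c) · facR t α (b − x)`. [cite: DavisRabinowitz1984, Sect. 2.12.4] -/
theorem rpow_right_split {b x1 α c m : ℚ} (hcm : c + m = b) {t : Bool} (hsep : t = false → α ≠ 0 → x1 < b)
    {x : ℝ} (hx : x ≤ (x1 : ℝ)) : ((b : ℝ) - x) ^ (α : ℝ) = wR t m α (x - c) * facR t α ((b : ℝ) - x) := by
  cases t
  · simp only [wR_false, one_mul, facR, Bool.not_false, Bool.true_and, decide_eq_true_eq]
    by_cases hα : α = 0
    · simp [hα]
    · have hlt : x < (b : ℝ) := lt_of_le_of_lt hx (by exact_mod_cast hsep rfl hα)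
      rw [if_pos hα, Real.rpow_def_of_pos (sub_pos.2 hlt), mul_comm (Real.log _)]
  · simp only [wR_true, facR, Bool.not_true, Bool.false_and, Bool.false_eq_true, if_false, mul_one]
    have : (c : ℝ) + m = b := by exact_mod_cast hcm
    congr 1
    linarith

/-- **The weight of one direction in the local coordinate** `u ∈ [−h, h]` of a leaf at distances `dl`, `dr` from
the root's left / right edge: the product of the moment-carried edge factors `(u + dl + h)^{αl}` (`ml`) and
`(dr + h − u)^{αr}` (`mr`). [cite: DavisRabinowitz1984, Sect. 2.12.5] -/
noncomputable def dirW (h dl dr αl αr : ℚ) (ml mr : Bool) (u : ℝ) : ℝ :=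
  wL ml (dl + h) αl u * wR mr (dr + h) αr u

/-- [folklore] -/
private theorem measurable_dirW (h dl dr αl αr : ℚ) (ml mr : Bool) : Measurable (dirW h dl dr αl αr ml mr) := by
  have h1 : Measurable (wL ml (dl + h) αl) := by
    cases ml
    · have e : wL false (dl + h) αl = fun _ => (1 : ℝ) := by funext u; simp
      rw [e]; exact measurable_const
    · have e : wL true (dl + h) αl = fun u : ℝ => (u + ((dl + h : ℚ) : ℝ)) ^ (αl : ℝ) := by funext u; simp [wL]
      rw [e]; exact (measurable_id.add_const _).pow_const _
  have h2 : Measurable (wR mr (dr + h) αr) := by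
    cases mr
    · have e : wR false (dr + h) αr = fun _ => (1 : ℝ) := by funext u; simp
      rw [e]; exact measurable_const
    · have e : wR true (dr + h) αr = fun u : ℝ => (((dr + h : ℚ) : ℝ) - u) ^ (αr : ℝ) := by funext u; simp [wR]
      rw [e]; exact (measurable_const.sub measurable_id).pow_const _
  exact h1.mul h2

/-- **The exact moments of a direction weight, with the acceptance flag**: plain moments if no edge factor of this
direction is carried by the moments; left / right edge moments `momG` / `momGR` through CHECKED power witnesses
`r₀ = dl^{α+1}`, `r₁ = (dl + 2h)^{α+1}` (so both distances of the leaf's ends to the singular edge must have rational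
`(α+1)`-th powers — the refinement heuristic cuts at such points); a leaf asking the moments to carry both edge factors
of one direction is rejected (Beta-function moments). [cite: DavisRabinowitz1984, Sect. 2.12.5] -/
def dirMom (h dl dr αl αr : ℚ) (ml mr : Bool) : (ℕ → ℚ) × Bool :=
  match ml, mr with
  | true, true => (momP h, false)
  | true, false =>
      (momG h dl αl (powWitness0 dl (αl + 1)) (powWitness (dl + 2 * h) (αl + 1)),
        witness0OK dl (αl + 1) (powWitness0 dl (αl + 1)) && witnessOK (dl + 2 * h) (αl + 1) (powWitness (dl + 2 * h) (αl + 1)))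
  | false, true =>
      (momGR h dr αr (powWitness0 dr (αr + 1)) (powWitness (dr + 2 * h) (αr + 1)),
        witness0OK dr (αr + 1) (powWitness0 dr (αr + 1)) && witnessOK (dr + 2 * h) (αr + 1) (powWitness (dr + 2 * h) (αr + 1)))
  | false, false => (momP h, true)

/-- **Soundness of the direction moments**: an accepted direction weight is interval integrable and nonnegative on
`[−h, h]`, and `∫_{-h}^{h} W(u) uⁱ du = (dirMom …).1 i` for every `i`. [cite: DavisRabinowitz1984, Sect. 2.12.5] -/
theorem dirMom_sound {h dl dr αl αr : ℚ} (h0 : 0 ≤ h) {ml mr : Bool} (hok : (dirMom h dl dr αl αr ml mr).2 = true) :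
    IntervalIntegrable (dirW h dl dr αl αr ml mr) volume (-(h : ℝ)) h ∧
      (∀ u : ℝ, |u| ≤ h → 0 ≤ dirW h dl dr αl αr ml mr u) ∧
      ∀ i : ℕ, ∫ u in (-(h : ℝ))..h, dirW h dl dr αl αr ml mr u * u ^ i =
        (((dirMom h dl dr αl αr ml mr).1 i : ℚ) : ℝ) := by
  have hhr : (0 : ℝ) ≤ h := by exact_mod_cast h0
  cases ml <;> cases mr
  · -- no edge factor carried by the moments: weight `1`
    have e : dirW h dl dr αl αr false false = fun _ => (1 : ℝ) := by funext u; simp [dirW]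
    rw [e]
    refine ⟨intervalIntegrable_const, fun u _ => zero_le_one, fun i => ?_⟩
    simpa [dirMom] using integral_one_mul_pow h i
  · -- right edge factor carried by the moments
    simp only [dirMom, Bool.and_eq_true] at hok ⊢
    obtain ⟨h0ok, h1ok⟩ := hok
    obtain ⟨hdr, hq, hr0⟩ := witness0OK_sound h0ok
    obtain ⟨-, -, hr1⟩ := witnessOK_sound h1ok
    have hβ : -1 < αr := by linarith
    have hβr : (-1 : ℝ) < αr := by exact_mod_cast hβ
    have hdrr : (0 : ℝ) ≤ dr := by exact_mod_cast hdr
    have hr0' : ((powWitness0 dr (αr + 1) : ℚ) : ℝ) = (dr : ℝ) ^ ((αr : ℝ) + 1) := by exact_mod_cast hr0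
    have hr1' : ((powWitness (dr + 2 * h) (αr + 1) : ℚ) : ℝ) = ((dr : ℝ) + 2 * h) ^ ((αr : ℝ) + 1) := by
      exact_mod_cast hr1
    have e : dirW h dl dr αl αr false true = fun u : ℝ => (((dr + h : ℚ) : ℝ) - u) ^ (αr : ℝ) := by
      funext u; simp [dirW, wR]
    rw [e]
    refine ⟨?_, fun u hu => Real.rpow_nonneg ?_ _, fun i => integral_rpowGR_mul_pow hβ h0 hdr hr0' hr1' i⟩
    · have h1 := (intervalIntegral.intervalIntegrable_rpow' (a := (dr : ℝ)) (b := (dr : ℝ) + 2 * h) hβr).comp_sub_left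
        (((dr + h : ℚ)) : ℝ)
      have ea : (((dr + h : ℚ)) : ℝ) - dr = h := by push_cast; ring
      have eb : (((dr + h : ℚ)) : ℝ) - ((dr : ℝ) + 2 * h) = -h := by push_cast; ring
      rw [ea, eb] at h1
      exact h1.symm
    · have := (abs_le.1 hu).2
      push_cast; linarith
  · -- left edge factor carried by the moments
    simp only [dirMom, Bool.and_eq_true] at hok ⊢
    obtain ⟨h0ok, h1ok⟩ := hok
    obtain ⟨hdl, hq, hr0⟩ := witness0OK_sound h0ok
    obtain ⟨-, -, hr1⟩ := witnessOK_sound h1ok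
    have hβ : -1 < αl := by linarith
    have hβr : (-1 : ℝ) < αl := by exact_mod_cast hβ
    have hdlr : (0 : ℝ) ≤ dl := by exact_mod_cast hdl
    have hr0' : ((powWitness0 dl (αl + 1) : ℚ) : ℝ) = (dl : ℝ) ^ ((αl : ℝ) + 1) := by exact_mod_cast hr0
    have hr1' : ((powWitness (dl + 2 * h) (αl + 1) : ℚ) : ℝ) = ((dl : ℝ) + 2 * h) ^ ((αl : ℝ) + 1) := by
      exact_mod_cast hr1
    have e : dirW h dl dr αl αr true false = fun u : ℝ => (u + ((dl + h : ℚ) : ℝ)) ^ (αl : ℝ) := by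
      funext u; simp [dirW, wL]
    rw [e]
    refine ⟨?_, fun u hu => Real.rpow_nonneg ?_ _, fun i => integral_rpowG_mul_pow hβ h0 hdl hr0' hr1' i⟩
    · have h1 := (intervalIntegral.intervalIntegrable_rpow' (a := (dl : ℝ)) (b := (dl : ℝ) + 2 * h) hβr).comp_add_right
        (((dl + h : ℚ)) : ℝ)
      have ea : (dl : ℝ) - (((dl + h : ℚ)) : ℝ) = -h := by push_cast; ring
      have eb : (dl : ℝ) + 2 * h - (((dl + h : ℚ)) : ℝ) = h := by push_cast; ring
      rw [ea, eb] at h1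
      exact h1
    · have := (abs_le.1 hu).1
      push_cast; linarith
  · simp [dirMom] at hok

/-- **Which edge factor of a direction the moments carry** — `(left?, right?)`, a soundness-free CHOICE: an edge the
leaf touches must be carried (both ⇒ `(true, true)`, rejected by the leaf rule); otherwise the nearer edge whose power
witnesses exist, else none (the factor then enters the Taylor model as `exp (α log ·)`).
[cite: DavisRabinowitz1984, Sect. 2.12.5] -/
def dirPlan (h dl dr αl αr : ℚ) : Bool × Bool :=
  let tl := decide (dl = 0 ∧ αl ≠ 0)
  let tr := decide (dr = 0 ∧ αr ≠ 0)
  if tl && tr then (true, true)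
  else if tl then (true, false)
  else if tr then (false, true)
  else
    let okl := decide (αl ≠ 0) && (dirMom h dl dr αl αr true false).2
    let okr := decide (αr ≠ 0) && (dirMom h dl dr αl αr false true).2
    if okl && (!okr || decide (dl ≤ dr)) then (true, false)
    else if okr then (false, true)
    else (false, false)

/-- **The smooth part of the weighted integrand on a leaf, as a code list**: `F` times the edge factors NOT carried by
the moments, each as `exp (α log (x − x0))`, … [cite: DavisRabinowitz1984, Sect. 2.12.4] -/
def gexpr (F : BExprT) (ω : WPrm) (R : Box2Q) (mx0 mx1 my0 my1 : Bool) : BExprT :=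
  withPow mx0 ω.xl (BExprT.sub BExprT.varX (BExprT.const R.x0))
    (withPow mx1 ω.xr (BExprT.sub (BExprT.const R.x1) BExprT.varX)
      (withPow my0 ω.yl (BExprT.sub BExprT.varY (BExprT.const R.y0))
        (withPow my1 ω.yr (BExprT.sub (BExprT.const R.y1) BExprT.varY) F)))

/-- [cite: DavisRabinowitz1984, Sect. 2.12.4] -/
theorem toFun₂_gexpr (F : BExprT) (ω : WPrm) (R : Box2Q) (mx0 mx1 my0 my1 : Bool) (x y : ℝ) :
    (gexpr F ω R mx0 mx1 my0 my1).toFun₂ x y =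
      F.toFun₂ x y * facR my1 ω.yr ((R.y1 : ℝ) - y) * facR my0 ω.yl (y - R.y0) * facR mx1 ω.xr ((R.x1 : ℝ) - x) *
        facR mx0 ω.xl (x - R.x0) := by
  simp only [gexpr, toFun₂_withPow, BExprT.toFun₂]

/-- **The leaf rule of the weighted certificate** for the leaf `B` of a kd-tree over the ROOT box `R`: local centre,
half-widths and distances to the root's edges; per direction the plan (which edge factor the moments carry); the
bivariate Taylor model of the smooth part `gexpr` (order / budgets `P`); its rational midpoint rows `q` integrated
EXACTLY against the direction moments (`wsum2`), widened by `⌈tabs2 (model − q) · μ₀ · ν₀⌉`; accepted iff the model and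
both directions' moments are accepted, every edge factor left to the model is separated from its edge (or absent),
`B ⊆ R`, and `B` is correctly oriented. [cite: DavisRabinowitz1984, Sect. 2.12.5] [cite: MakinoBerz2003, Algorithm 2] -/
def leafEnclW (S : ℕ) (F : BExprT) (ω : WPrm) (R B : Box2Q) (P : EPrm) : MI × Bool :=
  let h := (B.x1 - B.x0) / 2
  let k := (B.y1 - B.y0) / 2
  let dlx := B.x0 - R.x0
  let drx := R.x1 - B.x1
  let dly := B.y0 - R.y0
  let dry := R.y1 - B.y1
  let px := dirPlan h dlx drx ω.xl ω.xr
  let py := dirPlan k dly dry ω.yl ω.yr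
  let m := BExprT.model S h k P ((B.x0 + B.x1) / 2) ((B.y0 + B.y1) / 2) (gexpr F ω R px.1 px.2 py.1 py.2)
  let q := midRows S m.1
  let dx := dirMom h dlx drx ω.xl ω.xr px.1 px.2
  let dy := dirMom k dly dry ω.yl ω.yr py.1 py.2
  (MI.widen (ofRat S (wsum2 dx.1 dy.1 q)) ⌈(tabs2 S h k (tsub2 m.1 (ratPoly2 S q)) : ℚ) * dx.1 0 * dy.1 0⌉,
    m.2 && dx.2 && dy.2 &&
      (px.1 || decide (ω.xl = 0) || decide (R.x0 < B.x0)) && (px.2 || decide (ω.xr = 0) || decide (B.x1 < R.x1)) &&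
      (py.1 || decide (ω.yl = 0) || decide (R.y0 < B.y0)) && (py.2 || decide (ω.yr = 0) || decide (B.y1 < R.y1)) &&
      decide (R.x0 ≤ B.x0) && decide (B.x1 ≤ R.x1) && decide (R.y0 ≤ B.y0) && decide (B.y1 ≤ R.y1) &&
      decide (B.x0 ≤ B.x1) && decide (B.y0 ≤ B.y1))

/-- [folklore] -/
private theorem sep_of_flag {t : Bool} {α a b : ℚ} (h : (t = true ∨ α = 0) ∨ a < b) : t = false → α ≠ 0 → a < b := by
  intro ht hα
  rcases h with (h | h) | h
  · rw [ht] at h; exact absurd h Bool.false_ne_true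
  · exact absurd h hα
  · exact h

/-- **Soundness of the leaf rule**: an accepted leaf encloses `S · ∫_B w · F` and provides the integrability facts of
`BoxClaimR`. [cite: DavisRabinowitz1984, Sect. 2.12.5] [cite: MakinoBerz2003, Algorithm 2] -/
theorem leafEnclW_sound {S : ℕ} (hS : 0 < S) (F : BExprT) (ω : WPrm) (R B : Box2Q) (P : EPrm)
    (hok : (leafEnclW S F ω R B P).2 = true) : BoxClaimR S (wfun ω R F) B (leafEnclW S F ω R B P).1 := by
  simp only [leafEnclW, Bool.and_eq_true, Bool.or_eq_true, decide_eq_true_eq] at hok ⊢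
  obtain ⟨⟨⟨⟨⟨⟨⟨⟨⟨⟨⟨⟨hacc, hdx⟩, hdy⟩, hsx0⟩, hsx1⟩, hsy0⟩, hsy1⟩, hRx0⟩, hRx1⟩, hRy0⟩, hRy1⟩, hx⟩, hy⟩ := hok
  set h : ℚ := (B.x1 - B.x0) / 2 with hh
  set k : ℚ := (B.y1 - B.y0) / 2 with hk
  set cx : ℚ := (B.x0 + B.x1) / 2 with hcx
  set cy : ℚ := (B.y0 + B.y1) / 2 with hcy
  set dlx : ℚ := B.x0 - R.x0 with hdlx
  set drx : ℚ := R.x1 - B.x1 with hdrx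
  set dly : ℚ := B.y0 - R.y0 with hdly
  set dry : ℚ := R.y1 - B.y1 with hdry
  set px : Bool × Bool := dirPlan h dlx drx ω.xl ω.xr with hpx
  set py : Bool × Bool := dirPlan k dly dry ω.yl ω.yr with hpy
  set G : BExprT := gexpr F ω R px.1 px.2 py.1 py.2 with hG
  set q : List Poly := midRows S (BExprT.model S h k P cx cy G).1 with hq
  have h0 : 0 ≤ h := by rw [hh]; linarith
  have k0 : 0 ≤ k := by rw [hk]; linarith
  have hT := BExprT.tmem2_model hS h0 k0 P cx cy G hacc
  have hm : Measurable fun z : ℝ × ℝ => G.toFun₂ ((cx : ℝ) + z.1) ((cy : ℝ) + z.2) :=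
    (BExprT.measurable_toFun₂ G).comp
      ((measurable_const.add measurable_fst).prodMk (measurable_const.add measurable_snd))
  obtain ⟨hXi, hX0, hμ⟩ := dirMom_sound (dl := dlx) (dr := drx) (αl := ω.xl) (αr := ω.xr)
    (ml := px.1) (mr := px.2) h0 hdx
  obtain ⟨hYi, hY0, hν⟩ := dirMom_sound (dl := dly) (dr := dry) (αl := ω.yl) (αr := ω.yr)
    (ml := py.1) (mr := py.2) k0 hdy
  set WX : ℝ → ℝ := dirW h dlx drx ω.xl ω.xr px.1 px.2 with hWX
  set WY : ℝ → ℝ := dirW k dly dry ω.yl ω.yr py.1 py.2 with hWY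
  obtain ⟨hest, hI, hσ⟩ :=
    weighted_box hS h0 k0 hm hT (measurable_dirW k dly dry ω.yl ω.yr py.1 py.2) hXi hYi hX0 hY0 hμ hν q
  -- the pointwise identity on the closed leaf
  have hcmx0 : cx - (dlx + h) = R.x0 := by rw [hcx, hh, hdlx]; ring
  have hcmx1 : cx + (drx + h) = R.x1 := by rw [hcx, hh, hdrx]; ring
  have hcmy0 : cy - (dly + k) = R.y0 := by rw [hcy, hk, hdly]; ring
  have hcmy1 : cy + (dry + k) = R.y1 := by rw [hcy, hk, hdry]; ring
  have hpt : ∀ x : ℝ, (B.x0 : ℝ) ≤ x → x ≤ B.x1 → ∀ y : ℝ, (B.y0 : ℝ) ≤ y → y ≤ B.y1 →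
      wfun ω R F x y = WX (x - cx) * (WY (y - cy) * G.toFun₂ x y) := by
    intro x hx0 hx1 y hy0 hy1
    simp only [wfun, edgeW, hWX, hWY, dirW, hG, toFun₂_gexpr]
    rw [rpow_left_split hcmx0 (sep_of_flag hsx0) hx0, rpow_right_split hcmx1 (sep_of_flag hsx1) hx1,
      rpow_left_split hcmy0 (sep_of_flag hsy0) hy0, rpow_right_split hcmy1 (sep_of_flag hsy1) hy1]
    ring
  -- the translated limits and integrals
  have ex0 : (cx : ℝ) + -(h : ℝ) = (B.x0 : ℝ) := by rw [hcx, hh]; push_cast; ring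
  have ex1 : (cx : ℝ) + (h : ℝ) = (B.x1 : ℝ) := by rw [hcx, hh]; push_cast; ring
  have ey0 : (cy : ℝ) + -(k : ℝ) = (B.y0 : ℝ) := by rw [hcy, hk]; push_cast; ring
  have ey1 : (cy : ℝ) + (k : ℝ) = (B.y1 : ℝ) := by rw [hcy, hk]; push_cast; ring
  have einner : ∀ x : ℝ, ∫ y in (B.y0 : ℝ)..B.y1, WX (x - cx) * (WY (y - cy) * G.toFun₂ x y) =
      ∫ v in (-(k : ℝ))..k, WX (x - cx) * (WY v * G.toFun₂ ((cx : ℝ) + (x - cx)) ((cy : ℝ) + v)) := by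
    intro x
    have e1 := intervalIntegral.integral_comp_add_left
      (fun y => WX (x - cx) * (WY (y - cy) * G.toFun₂ x y)) (cy : ℝ) (a := -(k : ℝ)) (b := k)
    rw [ey0, ey1] at e1
    rw [← e1]
    refine intervalIntegral.integral_congr fun v _ => ?_
    simp only [add_sub_cancel_left, add_sub_cancel]
  have eouter : ∫ x in (B.x0 : ℝ)..B.x1, ∫ v in (-(k : ℝ))..k,
        WX (x - cx) * (WY v * G.toFun₂ ((cx : ℝ) + (x - cx)) ((cy : ℝ) + v)) =
      ∫ u in (-(h : ℝ))..h, ∫ v in (-(k : ℝ))..k, WX u * (WY v * G.toFun₂ ((cx : ℝ) + u) ((cy : ℝ) + v)) := by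
    have e1 := intervalIntegral.integral_comp_add_left
      (fun x => ∫ v in (-(k : ℝ))..k, WX (x - cx) * (WY v * G.toFun₂ ((cx : ℝ) + (x - cx)) ((cy : ℝ) + v)))
      (cx : ℝ) (a := -(h : ℝ)) (b := h)
    rw [ex0, ex1] at e1
    rw [← e1]
    refine intervalIntegral.integral_congr fun u _ => ?_
    simp only [add_sub_cancel_left]
  have hxx : (B.x0 : ℝ) ≤ B.x1 := by exact_mod_cast hx
  have hyy : (B.y0 : ℝ) ≤ B.y1 := by exact_mod_cast hy
  refine ⟨?_, ?_, ?_, hx, hy⟩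
  · -- membership: the integral over the leaf is the local weighted integral
    have ecast : ∫ x in (B.x0 : ℝ)..B.x1, ∫ y in (B.y0 : ℝ)..B.y1, wfun ω R F x y =
        ∫ x in (B.x0 : ℝ)..B.x1, ∫ y in (B.y0 : ℝ)..B.y1, WX (x - cx) * (WY (y - cy) * G.toFun₂ x y) := by
      refine intervalIntegral.integral_congr fun x hx' => ?_
      rw [uIcc_of_le hxx] at hx'
      refine intervalIntegral.integral_congr fun y hy' => ?_
      rw [uIcc_of_le hyy] at hy'
      exact hpt x hx'.1 hx'.2 y hy'.1 hy'.2
    rw [ecast]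
    simp_rw [einner]
    rw [eouter]
    refine MI.mem_widen (mem_ofRat S _) (hest.trans ?_)
    exact_mod_cast Int.le_ceil _
  · -- integrability of the inner integral on `[x0, x1]`
    have h1 := hI.comp_sub_right (cx : ℝ)
    have ea : -(h : ℝ) + (cx : ℝ) = (B.x0 : ℝ) := by rw [← ex0]; ring
    have eb : (h : ℝ) + (cx : ℝ) = (B.x1 : ℝ) := by rw [← ex1]; ring
    rw [ea, eb] at h1
    refine h1.congr fun x hx' => ?_
    rw [uIoc_of_le hxx] at hx'
    show (∫ v in (-(k : ℝ))..k, WX (x - cx) * (WY v * G.toFun₂ ((cx : ℝ) + (x - cx)) ((cy : ℝ) + v))) =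
      ∫ y in (B.y0 : ℝ)..B.y1, wfun ω R F x y
    rw [← einner x]
    refine intervalIntegral.integral_congr fun y hy' => ?_
    rw [uIcc_of_le hyy] at hy'
    exact (hpt x hx'.1.le hx'.2 y hy'.1 hy'.2).symm
  · -- integrability of every section
    intro x hx0 hx1
    have hu : |x - (cx : ℝ)| ≤ h := by
      rw [abs_le]; constructor <;> linarith [ex0, ex1]
    have h1 := (hσ (x - cx) hu).comp_sub_right (cy : ℝ)
    have ea : -(k : ℝ) + (cy : ℝ) = (B.y0 : ℝ) := by rw [← ey0]; ring
    have eb : (k : ℝ) + (cy : ℝ) = (B.y1 : ℝ) := by rw [← ey1]; ring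
    rw [ea, eb] at h1
    refine h1.congr fun y hy' => ?_
    rw [uIoc_of_le hyy] at hy'
    show WX (x - cx) * (WY (y - cy) * G.toFun₂ ((cx : ℝ) + (x - cx)) ((cy : ℝ) + (y - cy))) = wfun ω R F x y
    rw [add_sub_cancel, add_sub_cancel]
    exact (hpt x hx0 hx1 y hy'.1.le hy'.2).symm

/-! ### Part 5. The certificate, its soundness, and a refinement heuristic -/

/-- **Kernel obligation for leaf `i` of the weighted certificate** (one `decide` per leaf): root box `R`, weight
exponents `ω`, regular part `F`. [cite: DavisRabinowitz1984, Sect. 2.12.5] [cite: MahboubiMelquiondSibutpinote2016, Sect. 3.3] -/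
def leafCheckW (S : ℕ) (F : BExprT) (ω : WPrm) (R : Box2Q) (t : KdTree2) (i : ℕ) : Bool :=
  leafCheckR (leafEnclW S F ω R) t R i

/-- Final obligation (`= treeCheckG`: positivity of `S`, leaf count, `Σ claims ⊆ [lo·S, hi·S]`).
[cite: MahboubiMelquiondSibutpinote2016, Sect. 3.3] -/
def treeCheckW (S : ℕ) (t : KdTree2) (n : ℕ) (lo hi : ℚ) : Bool := treeCheckG S t n lo hi

/-- **Soundness of the weighted adaptive certificate** (no side hypotheses): if every leaf obligation and the final
obligation hold, then
`lo ≤ ∫_{x0}^{x1} ∫_{y0}^{y1} (x − x0)^{xl} (x1 − x)^{xr} · ((y − y0)^{yl} (y1 − y)^{yr} · F(x, y)) dy dx ≤ hi`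
— integrable algebraic edge and corner singularities (`−1 < exponent < 0`) and non-smooth edge factors
(`exponent > 0` non-integral) included. [cite: DavisRabinowitz1984, Sect. 2.12.5] [cite: MakinoBerz2003, Algorithm 2]
[cite: MahboubiMelquiondSibutpinote2016, Sect. 3.3] -/
theorem integral_bounds_of_leafCheckW {S : ℕ} {F : BExprT} {ω : WPrm} {R : Box2Q} {t : KdTree2} {n : ℕ}
    {lo hi : ℚ} (hleaf : ∀ i : ℕ, i < n → leafCheckW S F ω R t i = true) (ht : treeCheckW S t n lo hi = true) :
    (lo : ℝ) ≤ ∫ x in (R.x0 : ℝ)..R.x1, ∫ y in (R.y0 : ℝ)..R.y1,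
        (x - R.x0) ^ (ω.xl : ℝ) * ((R.x1 : ℝ) - x) ^ (ω.xr : ℝ) *
          ((y - R.y0) ^ (ω.yl : ℝ) * ((R.y1 : ℝ) - y) ^ (ω.yr : ℝ) * F.toFun₂ x y) ∧
      ∫ x in (R.x0 : ℝ)..R.x1, ∫ y in (R.y0 : ℝ)..R.y1,
        (x - R.x0) ^ (ω.xl : ℝ) * ((R.x1 : ℝ) - x) ^ (ω.xr : ℝ) *
          ((y - R.y0) ^ (ω.yl : ℝ) * ((R.y1 : ℝ) - y) ^ (ω.yr : ℝ) * F.toFun₂ x y) ≤ (hi : ℝ) :=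
  integral_bounds_of_leafCheckR (f := wfun ω R F) (Λ := leafEnclW S F ω R)
    (fun hS B P hok => leafEnclW_sound hS F ω R B P hok) hleaf ht

/-- Search for a **nice cut distance** `w ∈ [s0 + (s1−s0)/3, s1 − (s1−s0)/3]` of the form `(j / 2^e)^d` with the
smallest `e` (so that `w^{p/d}` is rational with a small denominator): candidates from `⌊·^{1/d}⌋` of the midpoint.
Soundness-free. [folklore] -/
private def niceCutAux (s0 s1 : ℚ) (d : ℕ) : ℕ → ℕ → Option ℚ
  | 0, _ => none
  | fuel + 1, e =>
      let T : ℕ := 2 ^ e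
      let lo := s0 + (s1 - s0) / 3
      let hi := s1 - (s1 - s0) / 3
      let M : ℚ := (s0 + s1) / 2 * (T : ℚ) ^ d
      let j := natRoot d M.floor.toNat
      let c1 : ℚ := ((j : ℚ) / T) ^ d
      let c2 : ℚ := (((j + 1 : ℕ) : ℚ) / T) ^ d
      if lo ≤ c1 ∧ c1 ≤ hi then some c1
      else if lo ≤ c2 ∧ c2 ≤ hi then some c2
      else niceCutAux s0 s1 d fuel (e + 1)

/-- [folklore] -/
private def niceCut (s0 s1 : ℚ) (d : ℕ) : Option ℚ := niceCutAux s0 s1 d 14 0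

/-- Is the nonnegative rational `r` the square of a rational?  Soundness-free. [folklore] -/
private def isSqQ (r : ℚ) : Bool :=
  decide (0 ≤ r) &&
    decide (((natRoot 2 r.num.toNat : ℚ) / (natRoot 2 r.den : ℚ)) ^ 2 = r)

/-- Search for a **Pythagorean cut** `x = a + L w ∈ [lo, hi]` with `w = (2mn/(m²+n²))²` or `((m²−n²)/(m²+n²))²`, so that
BOTH `x − a = L w` and `b − x = L (1 − w)` are rational squares (`L = b − a` a square): both children of the cut keep
square-root power witnesses at both edges.  Small `m` first; soundness-free. [folklore] -/
private def pythCutAux (a L lo hi : ℚ) : ℕ → ℕ → ℕ → Option ℚ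
  | 0, _, _ => none
  | fuel + 1, m, n =>
      if m ≤ n then pythCutAux a L lo hi fuel (m + 1) 1
      else
        let q : ℚ := ((m * m + n * n : ℕ) : ℚ)
        let x1 : ℚ := a + L * (((2 * m * n : ℕ) : ℚ) / q) ^ 2
        let x2 : ℚ := a + L * (((m * m - n * n : ℕ) : ℚ) / q) ^ 2
        if lo ≤ x1 ∧ x1 ≤ hi then some x1
        else if lo ≤ x2 ∧ x2 ≤ hi then some x2
        else pythCutAux a L lo hi fuel m (n + 1)

/-- [folklore] -/
private def pythCut (a b lo hi : ℚ) : Option ℚ :=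
  if isSqQ (b - a) then pythCutAux a (b - a) lo hi 1200 2 1 else none

/-- **Where to cut `[x0, x1]`** inside the root interval `[a, b]` with edge exponents `α` (at `a`), `β` (at `b`), in
the middle third: if both edges carry square-root-type factors, at a Pythagorean point (distances to BOTH edges rational
squares); else at a point whose distance to the (nearer) singular edge has a rational `(exponent+1)`-th power — so that
the children keep their power witnesses — else at the midpoint. Soundness-free.
[cite: MahboubiMelquiondSibutpinote2016, Sect. 3.3] -/
def cutW (x0 x1 a b α β : ℚ) : ℚ :=
  let mid := (x0 + x1) / 2
  let lo := x0 + (x1 - x0) / 3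
  let hi := x1 - (x1 - x0) / 3
  let both : Option ℚ :=
    if α ≠ 0 ∧ β ≠ 0 ∧ (α + 1).den = 2 ∧ (β + 1).den = 2 then pythCut a b lo hi else none
  match both with
  | some x => x
  | none =>
      if α ≠ 0 ∧ (β = 0 ∨ x0 - a ≤ b - x1) then
        match niceCut (x0 - a) (x1 - a) (α + 1).den with
        | some w => a + w
        | none => mid
      else if β ≠ 0 then
        match niceCut (b - x1) (b - x0) (β + 1).den with
        | some w => b - w
        | none => mid
      else mid

/-- **Refinement heuristic for the weighted certificate**: a leaf whose enclosure is rejected or wider than `tol`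
(scaled by `S`) is split, at most `depth` deep — first in a direction whose moments are rejected (touching leaf without
a power witness, or touching both singular edges), else along the longer side — at the cut `cutW`.  A PROPOSAL, certified
leaf by leaf by `leafCheckW`. [cite: MahboubiMelquiondSibutpinote2016, Sect. 3.3] -/
def kdRefineW (S : ℕ) (F : BExprT) (ω : WPrm) (R : Box2Q) (P : EPrm) (tol : ℤ) : ℕ → Box2Q → KdTree2
  | 0, B => KdTree2.leaf P (leafEnclW S F ω R B P).1
  | d + 1, B =>
      let e := leafEnclW S F ω R B P
      if e.2 && decide (e.1.hi - e.1.lo ≤ tol) then KdTree2.leaf P e.1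
      else
        let h := (B.x1 - B.x0) / 2
        let k := (B.y1 - B.y0) / 2
        let px := dirPlan h (B.x0 - R.x0) (R.x1 - B.x1) ω.xl ω.xr
        let py := dirPlan k (B.y0 - R.y0) (R.y1 - B.y1) ω.yl ω.yr
        let dx := dirMom h (B.x0 - R.x0) (R.x1 - B.x1) ω.xl ω.xr px.1 px.2
        let dy := dirMom k (B.y0 - R.y0) (R.y1 - B.y1) ω.yl ω.yr py.1 py.2
        let splitX : Bool := if !dx.2 then true else if !dy.2 then false else decide (B.y1 - B.y0 ≤ B.x1 - B.x0)
        if splitX then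
          let c := cutW B.x0 B.x1 R.x0 R.x1 ω.xl ω.xr
          KdTree2.splitX c (kdRefineW S F ω R P tol d ⟨B.x0, c, B.y0, B.y1⟩)
            (kdRefineW S F ω R P tol d ⟨c, B.x1, B.y0, B.y1⟩)
        else
          let c := cutW B.y0 B.y1 R.y0 R.y1 ω.yl ω.yr
          KdTree2.splitY c (kdRefineW S F ω R P tol d ⟨B.x0, B.x1, B.y0, c⟩)
            (kdRefineW S F ω R P tol d ⟨B.x0, B.x1, c, B.y1⟩)

end PolyMP

end Literature.Analysis.ValidatedNumerics
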